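import Summits.HodgeConjecture.CorCM.D2Bridge.ClosedPrintedMuKeyIdentLemD3DelRecConjOmegaT
import Summits.HodgeConjecture.CorCM.B01.Transposition.Item6OmegaChiSplitting
import Literature.NumberTheory.Automorphic.Liu2021.Def411WeilCarriersLocalDataAtV
import Literature.NumberTheory.Automorphic.IdeleClassCharacterHecke
import Literature.RepresentationTheory.Liu2021.OscillatorConventions
import Literature.NumberTheory.GelbartRogawski1991.CMSplittingCharLocalMu
import Literature.NumberTheory.Automorphic.Liu2021.LemD1AsPrintedIndexedNonVacuityNonsplitPlace
import Literature.NumberTheory.Automorphic.Liu2021.LemD1SplitPlaceOfFacts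
import HarnessLib

/-!
# `hD3` line `a4-liuD3`, stub (:199) `stub_sameClass_of_split : SameClassOfSplit` — CLOSED IN THE TREE, BY NAME
# (cell `hodgecm-mathlib`, binder `HypD3` = [Liu2021, App. D Lem. D.1 (3)] AS PRINTED per finite place; crux item stmt-HodgeConjecture-24837)

Summits side, binder subdirectory `CorCM/HypD3/`.  The crux skeleton `A-plan/lines/a4-liuD3.lean` (v1 sha16 5422b04d6cb4d0fa, REF1 PASS
2026-08-28T02:57:41Z, namespace `Summit.HodgeConjecture.CorCM.Lines.A4LiuD3`) cuts `hD3` into five stubs over the family of record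
`famAtV F e dV hdV hdV0 ψ hψ aOf χOf v := Def411WeilCarriers.localIndexedFamilyAtV F⁺ F c 3 e (diagonal dV) … v` (`F⁺ = maximalRealSubfield F`,
`c = complexConj`, ONE trace-zero `δ = imagUnit F`, member `t ↦ (a_t, χ_t, χ-splitting of μ_t, localMu μ_t)`).  Its stub (:199) is the `ε`-clause of
(3) at a place `v` of `F⁺` SPLIT in `F` (`¬ IsField (F ⊗ F⁺_v)`): ALL members' Step-1 representatives `ε_t = (a_t·δ) ⊗ 1` lie in ONE class of
`E_v^{−×}/Nm E_vˣ` (`LemD1.SameClass`).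

This file PROVES that statement with `famAtV` replaced by its definiens (character-identical to the skeleton's :102; the stub then closes by
`exact Summit.HodgeConjecture.CorCM.HypD3.sameClassOfSplit` — `famAtV` unfolds by `δ`-reduction; for the pending v2 (`e ↦ e₁`, RULING 02:54:52Z)
instantiate `e := e₁`).  PROOF (fan B tree theorems, no new fact, debt Δ 0): `E_v` not a field ⇒ a place `w ∣ v` with `c • w ≠ w`
(`Liu2021.SplitPlace.exists_placesOver_smul_ne_of_not_isField`, B-p01) ⇒ any two representatives of the place model's standing data are in one class
(`Liu2021.LemD1IndexedNonVacuityNonsplitPlace.sameClass_of_split`: at a split place every unit of `F⁺_v` is a norm `x xᶜ` from `E_w × E_w̄`,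
[CasselsFrohlichANT1967, Ch. II §10]); the standing data's Prop slots (`J_V` hermitian, `det J_V ≠ 0`) are filled by proof irrelevance.
Kernel-checked first against the skeleton copy `B-provers/SkeletonCheck-a4-liuD3-v1-stub4-sameClassOfSplit.lean` (7fe89dab31b6908c: rc 0, sorries 5 → 4).

HC_CM is proved only modulo the 7 printed citations (`hDel`, `h21`, `hLiu418`, `h411`, `h413`, `hD3`, `hD1''`) until rung 0 closes; this file
discharges no binder by itself (the four other stubs of the line remain).

## References
* [Liu2021] Y. Liu, Camb. J. Math. 9 (2021) = arXiv:2102.11518, App. D Lemma D.1 (3) (l. 5233); proof, split case (l. 5249–5254).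
* [CasselsFrohlichANT1967] J. W. S. Cassels, A. Fröhlich (eds.), *Algebraic Number Theory* (1967), Ch. II §10 (`L ⊗_K K_v = ∏_{w∣v} L_w`).
-/

set_option autoImplicit false

noncomputable section

namespace Summit.HodgeConjecture.CorCM.HypD3
open scoped TensorProduct Matrix
open NumberField NumberField.InfinitePlace
open HodgeCM.Model HodgeCM.Model.LiuIndex HodgeCM.Model.TowerCarrier
open HodgeCM.Literature.Theta.LiuAlbaneseModuleDatum.D2Bridge (HcmPieces)
open Summit.HodgeConjecture.CorCM.Model
open Literature.AlgebraicGeometry.Motives (CMType)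
open Literature.AlgebraicGeometry.HodgeTheory Literature.NumberTheory.Automorphic.PicardCM
open Literature.AlgebraicGeometry.ShimuraVarieties.UnitaryCanonicalModel
open Literature.NumberTheory.ComplexMultiplication
open Literature.NumberTheory.Automorphic
open Literature.NumberTheory.Automorphic.IdeleClassGroup (toHeckeCharacter isUnitary_toHeckeCharacter galConj)
open Literature.NumberTheory.Automorphic.Liu2021 Literature.NumberTheory.Automorphic.Liu2021.AppendixC
open Literature.NumberTheory.Automorphic.Liu2021.AppendixC.RestOne
open Literature.NumberTheory.Automorphic.Liu2021.Def411WeilCarriers (lineOf locF Rep)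
open Summit.HodgeConjecture.CorCM.Transposition.OmegaTransport (realUnit)
open HodgeCM.Model.ArchSideTerm (e₁)
open Literature.NumberTheory.GelbartRogawski1991 Literature.NumberTheory.GelbartRogawski1991.UnitaryDualPair
open Literature.NumberTheory.GelbartRogawski1991.UnitaryDualPair.LocalSplitting (localMu norm_localMu continuous_localMu localMu_toLocalRing_eq_one_iff
  eq_of_forall_localMu_toHeckeCharacter_eq)
open Literature.RepresentationTheory Literature.RepresentationTheory.Liu2021
open Summit.HodgeConjecture.CorCM.Transposition
open Summit.HodgeConjecture.CorCM.D2Bridge.AdapterMuConj (muConj prop413AsPrinted_muConj def411_muConj nontrivial_omegaAt_muConj_rest)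
open Summit.HodgeConjecture.CorCM.D2Bridge.MuKeyIdentEnd (hc_cm_of_printed_citations_muKey_ident)
open Summit.HodgeConjecture.CorCM.D2Bridge.MuKeyIdentLemD3End
open Summit.HodgeConjecture.CorCM.D2Bridge.MuKeyIdentLemD3DelRecConjOmegaEnd (diagonal_frameD_map_complexConj)
open Summit.HodgeConjecture.CorCM.D2Bridge.MuKeyIdentLemD3DelRecConjOmegaEndT (hc_cm_of_printed_citations_muKey_ident_lemD3_delRecConjOmegaT)
open MeasureTheory

/-- **Line `a4-liuD3`, stub (:199) `SameClassOfSplit`, PROVED** — at a place `v` of `F⁺` split in `F`, all Step-1 representatives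
`ε_t = (a_t·δ) ⊗ 1` of the family of record lie in ONE class of `E_v^{−×}/Nm_{E_v/F⁺_v} E_vˣ`: for every CM field `F` (as `HodgeCM.CMField`),
bijection `e`, real frame `dV` (`c dV_i = dV_i ≠ 0`), index maps `ψ, hψ, aOf, χOf` and finite place `v` of `F⁺` with `F ⊗ F⁺_v` NOT a field,
`LemD1.SameClass (ε_i) (ε_j)` for all members `i, j`.  Statement = the body of `Summit.HodgeConjecture.CorCM.Lines.A4LiuD3.SameClassOfSplit`
(a4-liuD3.lean v1 5422b04d6cb4d0fa :158) with `famAtV` unfolded to its definiens (:102), character for character; proof = fan B's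
`sameClass_of_split` at a `c`-moved place over `v` (`exists_placesOver_smul_ne_of_not_isField`).
[cite: Liu2021, App. D Lemma D.1 (3) (l. 5233), proof l. 5249–5254] [cite: CasselsFrohlichANT1967, Ch. II §10] -/
theorem sameClassOfSplit :
    ∀ (F : HodgeCM.CMField) (e : Fin 3 × Fin 1 ≃ Fin 3) (dV : Fin 3 → (F : Type))
      (hdV : ∀ i, IsCMField.complexConj (F : Type) (dV i) = dV i) (hdV0 : ∀ i, dV i ≠ 0) {ι : Type}
      (ψ : ι → (Literature.NumberTheory.Automorphic.IdeleClassGroup (F : Type) →ₜ* Circle))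
      (hψ : ∀ t, IdeleClassGroup.IsConjugateSymplectic (F : Type) (ψ t))
      (aOf : ι → (↥(maximalRealSubfield (F : Type)))ˣ)
      (χOf : ι → Def411WeilCarriers.Chi ↥(maximalRealSubfield (F : Type)) (F : Type) (IsCMField.complexConj (F : Type)))
      (v : IsDedekindDomain.HeightOneSpectrum (𝓞 ↥(maximalRealSubfield (F : Type)))),
      ¬ IsField (UnitaryGroup.LocalRing (F : Type) v) →
      ∀ i j : ι,
        LemD1.SameClass
          ((Def411WeilCarriers.localIndexedFamilyAtV (ι := ι) ↥(maximalRealSubfield (F : Type)) (F : Type) (IsCMField.complexConj (F : Type)) 3 e (Matrix.diagonal dV) (complexConj_imagUnit (F : Type)) (imagUnit_ne_zero (F : Type)) (imagUnit_mul_self (F : Type)) (realDiagonal_isSymm (F : Type) dV hdV) (isUnit_det_realDiagonal (F : Type) dV hdV hdV0) (realDiagonal_map (F : Type) dV hdV).symm (le_refl 3) aOf χOf (fun t => OmegaChiSplitting.chiLocalSplittingsD ⟨HodgeCM.CMField.K F⟩ e dV hdV hdV0 (toHeckeCharacter (F : Type) (ψ t)) ((isOscillatorChar_toHeckeCharacter_iff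 (ψ t)).mpr (hψ t)) (aOf t)) (fun t => localMu (F : Type) (toHeckeCharacter (F : Type) (ψ t))) (fun t v x => norm_localMu (F : Type) (toHeckeCharacter (F : Type) (ψ t)) v (isUnitary_toHeckeCharacter (F : Type) (ψ t)) x) (fun t => continuous_localMu (F : Type) (toHeckeCharacter (F : Type) (ψ t))) (fun t v x => localMu_toLocalRing_eq_one_iff (F : Type) (toHeckeCharacter (F : Type) (ψ t)) v ((isOscillatorChar_toHeckeCharacter_iff (ψ t)).mpr (hψ t)) x) v).eps i)
          ((Def411WeilCarriers.localIndexedFamilyAtV (ι := ι) ↥(maximalRealSubfield (F : Type)) (F : Type) (IsCMField.complexConj (F : Type)) 3 e (Matrix.diagonal dV) (complexConj_imagUnit (F : Type)) (imagUnit_ne_zero (F : Type)) (imagUnit_mul_self (F : Type)) (realDiagonal_isSymm (F : Type) dV hdV) (isUnit_det_realDiagonal (F : Type) dV hdV hdV0) (realDiagonal_map (F : Type) dV hdV).symm (le_refl 3) aOf χOf (fun t => OmegaChiSplitting.chiLocalSplittingsD ⟨HodgeCM.CMField.K F⟩ e dV hdV hdV0 (toHeckeCharacter (F : Type) (ψ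 t)) ((isOscillatorChar_toHeckeCharacter_iff (ψ t)).mpr (hψ t)) (aOf t)) (fun t => localMu (F : Type) (toHeckeCharacter (F : Type) (ψ t))) (fun t v x => norm_localMu (F : Type) (toHeckeCharacter (F : Type) (ψ t)) v (isUnitary_toHeckeCharacter (F : Type) (ψ t)) x) (fun t => continuous_localMu (F : Type) (toHeckeCharacter (F : Type) (ψ t))) (fun t v x => localMu_toLocalRing_eq_one_iff (F : Type) (toHeckeCharacter (F : Type) (ψ t)) v ((isOscillatorChar_toHeckeCharacter_iff (ψ t)).mpr (hψ t)) x) v).eps j) := by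
  intro F e dV hdV hdV0 ι ψ hψ aOf χOf v hE i j
  -- a place `w ∣ v` moved by `c` (`E_v` is not a field)
  obtain ⟨w, hw⟩ := Literature.NumberTheory.Automorphic.Liu2021.SplitPlace.exists_placesOver_smul_ne_of_not_isField (F : Type) v
    (IsCMField.complexConj (F : Type))
    (UnitaryGroup.algEquiv_ne_one_of_apply_eq_neg ↥(maximalRealSubfield (F : Type)) (F : Type) (IsCMField.complexConj (F : Type))
      (complexConj_imagUnit (F : Type)) (imagUnit_ne_zero (F : Type))) hE
  -- ONE ε-class for the place model's standing data at a split place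
  refine Literature.NumberTheory.Automorphic.Liu2021.LemD1IndexedNonVacuityNonsplitPlace.sameClass_of_split (F : Type) v
    (IsCMField.complexConj (F : Type)) (complexConj_imagUnit (F : Type)) (imagUnit_ne_zero (F : Type)) 3 (Matrix.diagonal dV)
    (by norm_num) ?_ ?_ w hw _ _
  · rw [Matrix.diagonal_map (map_zero _), Matrix.diagonal_transpose]
    exact congrArg Matrix.diagonal (funext hdV)
  · rw [Matrix.det_diagonal]
    exact Finset.prod_ne_zero_iff.mpr fun k _ => hdV0 k

end Summit.HodgeConjecture.CorCM.HypD3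

end
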